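import Summits.Ventures.PercRepro.S2CubeMultiplicity

/-!
# PercRepro — S2: THE QUARTIC MULTIPLICITY, PART A — two good triples per quadruple of extras
(p4, gen 17; paper proofs/P4-gen17.md §2, LEMMA Q; the sequel of S2CubeMultiplicity)

`three_le_eRk_of_four`: four distinct points have rank `≥ 3` when every circuit has `≥ 3` elements and every
rank-`2` set has `≤ 3` points. `two_le_card_filter_good_triples`: for `I` independent and four distinct extras
`e, f, g, h ∈ cl(I) ∖ I`, at least two triples `P ⊆ I` satisfy `I ⊆ cl((I ∖ P) ∪ {e, f, g, h})` — under (C1) and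
(C2) (every rank-`≤ 3` set has `≤ 6` points). Proof: an independent `3`-subset `T₀` of `T` extends to a basis
`T₀ ∪ I′` of `I ∪ T₀`, and `P₀ = I ∖ I′` is good; by (C2) some support element `u ∈ I′` exists (`u ∈ C(t, I)` for
some `t ∈ T`; otherwise `P₀ ∪ T` is a rank-`3` set of `7` points); with `J = I′ ∖ {u}` either `J ∪ T` spans
(every `P₀ − v + u` is good) or some `v ∈ P₀` lies outside the hyperplane `cl(J ∪ T)` (all three inside would make
`cl(J ∪ T) = cl(I ∖ {u}) ∋ t`, against `u ∈ C(t, I)`), and `P₀ − v + u` is good. Axioms: standard.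
-/

open scoped Matroid

namespace PercRepro

namespace S2

open Set

variable {α : Type} {M : Matroid α}

/-- Four distinct points of `M.E` have rank `≥ 3` (every circuit has `≥ 3` elements, every rank-`2` set has
`≤ 3` points). -/
theorem three_le_eRk_of_four [M.Finite] (hcirc : ∀ C, M.IsCircuit C → 3 ≤ C.encard)
    (hC1 : ∀ L ⊆ M.E, M.eRk L = 2 → L.ncard ≤ 3) {e f g h : α}
    (heE : e ∈ M.E) (hfE : f ∈ M.E) (hgE : g ∈ M.E) (hhE : h ∈ M.E)
    (hef : e ≠ f) (heg : e ≠ g) (heh : e ≠ h) (hfg : f ≠ g) (hfh : f ≠ h) (hgh : g ≠ h) :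
    (3 : ℕ∞) ≤ M.eRk ({e, f, g, h} : Set α) := by
  set T : Set α := {e, f, g, h} with hT
  have hTE : T ⊆ M.E := by
    intro t ht
    rcases ht with rfl | rfl | rfl | rfl <;> assumption
  have hTcard : T.ncard = 4 := by
    rw [hT, Set.ncard_insert_of_notMem (by simp [hef, heg, heh]),
      Set.ncard_insert_of_notMem (by simp [hfg, hfh]), Set.ncard_pair hgh]
  obtain ⟨k, hk⟩ := exists_eRk_eq_coe (M := M) T
  rw [hk]
  by_contra hlt
  push Not at hlt
  have hk3 : k < 3 := by exact_mod_cast hlt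
  rcases Nat.lt_or_ge k 2 with hk2 | hk2
  · -- rank `≤ 1`: `{e, f}` is dependent, a circuit of `≤ 2` elements
    have hef2 : M.eRk ({e, f} : Set α) ≤ 1 := by
      have h1 : M.eRk ({e, f} : Set α) ≤ M.eRk T := M.eRk_mono (by
        intro x hx
        rcases hx with rfl | rfl
        · exact Or.inl rfl
        · exact Or.inr (Or.inl rfl))
      rw [hk] at h1
      exact h1.trans (by exact_mod_cast (show k ≤ 1 by omega))
    have hefE : ({e, f} : Set α) ⊆ M.E := by
      intro x hx
      rcases hx with rfl | rfl
      · exact heE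
      · exact hfE
    have hdep : M.Dep ({e, f} : Set α) := by
      rw [← Matroid.not_indep_iff hefE]
      intro hind
      have := hind.eRk_eq_encard
      rw [Set.encard_pair hef] at this
      rw [this] at hef2
      exact absurd hef2 (by norm_num)
    obtain ⟨C, hCsub, hC⟩ := hdep.exists_isCircuit_subset
    have h3 := hcirc C hC
    have h4 : C.encard ≤ 2 := by
      have := Set.encard_le_encard hCsub
      rwa [Set.encard_pair hef] at this
    exact absurd (h3.trans h4) (by norm_num)
  · -- rank `2`: four points on a line
    have hk2' : k = 2 := by omega
    have := hC1 T hTE (by rw [hk, hk2']; rfl)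
    omega

open scoped Classical in
/-- **TWO GOOD TRIPLES PER QUADRUPLE OF EXTRAS** (LEMMA Q of proofs/P4-gen17.md §2): for `I` independent and four
distinct extras `e, f, g, h ∈ cl(I) ∖ I`, at least two triples `P ⊆ I` satisfy `I ⊆ cl((I ∖ P) ∪ {e, f, g, h})`
(every circuit has `≥ 3` elements, every rank-`2` set has `≤ 3` points, every rank-`≤ 3` set has `≤ 6` points). -/
theorem two_le_card_filter_good_triples [M.Finite] {I : Finset α} {e f g h : α}
    (hcirc : ∀ C, M.IsCircuit C → 3 ≤ C.encard) (hC1 : ∀ L ⊆ M.E, M.eRk L = 2 → L.ncard ≤ 3)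
    (hC2 : ∀ L ⊆ M.E, M.eRk L ≤ 3 → L.ncard ≤ 6)
    (hI : M.Indep (I : Set α)) (hIE : (I : Set α) ⊆ M.E)
    (he : e ∈ M.closure (I : Set α)) (hf : f ∈ M.closure (I : Set α)) (hg : g ∈ M.closure (I : Set α))
    (hh : h ∈ M.closure (I : Set α))
    (heI : e ∉ I) (hfI : f ∉ I) (hgI : g ∉ I) (hhI : h ∉ I)
    (hef : e ≠ f) (heg : e ≠ g) (heh : e ≠ h) (hfg : f ≠ g) (hfh : f ≠ h) (hgh : g ≠ h) :
    2 ≤ ((I.powersetCard 3).filter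
      (fun P : Finset α => (I : Set α) ⊆ M.closure (((I : Set α) \ (P : Set α)) ∪ {e, f, g, h}))).card := by
  set T : Set α := {e, f, g, h} with hT
  have hTcl : T ⊆ M.closure (I : Set α) := by
    intro t ht
    rcases ht with rfl | rfl | rfl | rfl <;> assumption
  have hTE : T ⊆ M.E := hTcl.trans (M.closure_subset_ground _)
  have hTI : ∀ t ∈ T, t ∉ (I : Set α) := by
    intro t ht
    rcases ht with rfl | rfl | rfl | rfl <;> assumption
  have hTcard : T.ncard = 4 := by
    rw [hT, Set.ncard_insert_of_notMem (by simp [hef, heg, heh]),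
      Set.ncard_insert_of_notMem (by simp [hfg, hfh]), Set.ncard_pair hgh]
  have hTfin : T.Finite := Set.toFinite T
  have hrT : (3 : ℕ∞) ≤ M.eRk T :=
    three_le_eRk_of_four hcirc hC1 (hTE (by simp [hT])) (hTE (by simp [hT])) (hTE (by simp [hT]))
      (hTE (by simp [hT])) hef heg heh hfg hfh hgh
  -- an independent `3`-subset `T₀` of `T`
  obtain ⟨J₀, hJ₀⟩ := M.exists_isBasis T hTE
  have hJ₀card : (3 : ℕ∞) ≤ J₀.encard := by rw [hJ₀.encard_eq_eRk]; exact hrT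
  obtain ⟨T₀, hT₀J, hT₀card⟩ := Set.exists_subset_encard_eq hJ₀card
  have hT₀ind : M.Indep T₀ := hJ₀.indep.subset hT₀J
  have hT₀T : T₀ ⊆ T := hT₀J.trans hJ₀.subset
  have hT₀I : Disjoint (I : Set α) T₀ := by
    rw [Set.disjoint_left]
    intro x hx hx'
    exact hTI x (hT₀T hx') hx
  -- extend `T₀` to a basis `J'` of `I ∪ T₀`
  have hIT₀cl : (I : Set α) ∪ T₀ ⊆ M.closure (I : Set α) :=
    Set.union_subset (M.subset_closure _ hIE) (hT₀T.trans hTcl)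
  obtain ⟨J', hJ', hT₀J'⟩ := hT₀ind.subset_isBasis_of_subset
    (Set.subset_union_right : T₀ ⊆ (I : Set α) ∪ T₀) (hIT₀cl.trans (M.closure_subset_ground _))
  have hJ'sub : J' ⊆ (I : Set α) ∪ T₀ := hJ'.subset
  have hJ'card : J'.encard = (I.card : ℕ∞) := by
    rw [hJ'.encard_eq_eRk]
    have h2 := eRk_le_card_of_subset_closure hI hIT₀cl
    have h3 : M.eRk (I : Set α) ≤ M.eRk ((I : Set α) ∪ T₀) := M.eRk_mono Set.subset_union_left
    rw [hI.eRk_eq_encard, Set.encard_coe_eq_coe_finsetCard] at h3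
    exact le_antisymm h2 h3
  -- `I′ = I ∩ J'` (as a `Finset`), `P₀ = I ∖ J'`
  set I' : Finset α := I.filter (fun x => x ∈ J') with hI'def
  have hI'I : I' ⊆ I := Finset.filter_subset _ _
  set P₀ : Finset α := I \ I' with hP₀def
  have hP₀I : P₀ ⊆ I := Finset.sdiff_subset
  have hJ'eq : J' = (I' : Set α) ∪ T₀ := by
    ext x
    simp only [hI'def, Finset.coe_filter, Set.mem_union, Set.mem_setOf_eq]
    constructor
    · intro hx
      rcases hJ'sub hx with hxI | hxT
      · exact Or.inl ⟨hxI, hx⟩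
      · exact Or.inr hxT
    · rintro (⟨-, hx⟩ | hx)
      · exact hx
      · exact hT₀J' hx
  have hI'card : I'.card + 3 = I.card := by
    have hdisj : Disjoint (I' : Set α) T₀ := hT₀I.mono_left (by exact_mod_cast hI'I)
    have h1 := hJ'card
    rw [hJ'eq, Set.encard_union_eq hdisj, Set.encard_coe_eq_coe_finsetCard, hT₀card] at h1
    exact_mod_cast h1
  have hP₀card : P₀.card = 3 := by
    rw [hP₀def, Finset.card_sdiff_of_subset hI'I]
    omega
  have hP₀E : (P₀ : Set α) ⊆ M.E := (Finset.coe_subset.2 hP₀I).trans hIE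
  have hP₀ind : M.Indep (P₀ : Set α) := hI.subset (by exact_mod_cast hP₀I)
  -- `P₀` is good: `J' ⊆ (I ∖ P₀) ∪ T`
  have hJ'le : J' ⊆ ((I : Set α) \ (P₀ : Set α)) ∪ T := by
    intro x hx
    rcases hJ'sub hx with hxI | hxT
    · left
      refine ⟨hxI, ?_⟩
      rw [hP₀def, Finset.coe_sdiff, Set.mem_sdiff, not_and, not_not]
      intro _
      rw [hI'def, Finset.coe_filter]
      exact ⟨by exact_mod_cast hxI, hx⟩
    · exact Or.inr (hT₀T hxT)
  have hgood₀ : (I : Set α) ⊆ M.closure (((I : Set α) \ (P₀ : Set α)) ∪ T) := by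
    have h1 : (I : Set α) ⊆ M.closure J' := by
      rw [hJ'.closure_eq_closure]
      exact Set.subset_union_left.trans (M.subset_closure _ (hIT₀cl.trans (M.closure_subset_ground _)))
    exact h1.trans (M.closure_subset_closure hJ'le)
  -- a support element `u ∉ P₀`
  have hu : ∃ u ∈ I, u ∉ P₀ ∧ ∃ t ∈ T, u ∈ M.fundCircuit t (I : Set α) := by
    by_contra hcon
    push Not at hcon
    have hTP₀ : T ⊆ M.closure (P₀ : Set α) := by
      intro t ht
      have hC := hI.fundCircuit_isCircuit (hTcl ht) (hTI t ht)
      have h1 : t ∈ M.closure (M.fundCircuit t (I : Set α) \ {t}) :=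
        hC.mem_closure_sdiff_singleton_of_mem (M.mem_fundCircuit t (I : Set α))
      refine M.closure_subset_closure ?_ h1
      intro x hx
      have hxI : x ∈ I := by
        rcases M.fundCircuit_subset_insert t (I : Set α) hx.1 with hxt | hxI
        · exact absurd hxt hx.2
        · exact_mod_cast hxI
      by_contra hxP
      exact hcon x hxI hxP t ht hx.1
    have hrk : M.eRk ((P₀ : Set α) ∪ T) ≤ 3 := by
      have h1 : (P₀ : Set α) ∪ T ⊆ M.closure (P₀ : Set α) :=
        Set.union_subset (M.subset_closure _ hP₀E) hTP₀
      have h2 := eRk_le_card_of_subset_closure hP₀ind h1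
      rw [hP₀card] at h2
      exact_mod_cast h2
    have h6 := hC2 _ (Set.union_subset hP₀E hTE) hrk
    have hdisj : Disjoint (P₀ : Set α) T := by
      rw [Set.disjoint_left]
      intro x hx hxT
      exact hTI x hxT (by exact_mod_cast hP₀I hx)
    have h7 : ((P₀ : Set α) ∪ T).ncard = 7 := by
      rw [Set.ncard_union_eq hdisj P₀.finite_toSet hTfin, Set.ncard_coe_finset, hP₀card, hTcard]
    omega
  obtain ⟨u, huI, huP₀, t, htT, hut⟩ := hu
  have huI' : u ∈ (I : Set α) := by exact_mod_cast huI
  have huP₀' : u ∉ (P₀ : Set α) := by exact_mod_cast huP₀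
  have htu : t ∉ M.closure ((I : Set α) \ {u}) :=
    (mem_fundCircuit_iff_notMem_closure_sdiff hI (hTcl htT) (hTI t htT) huI').1 hut
  -- `J = (I ∖ P₀) ∖ {u}`
  set J : Set α := ((I : Set α) \ (P₀ : Set α)) \ {u} with hJdef
  have hJins : insert u (J ∪ T) = ((I : Set α) \ (P₀ : Set α)) ∪ T := by
    ext x
    simp only [hJdef, Set.mem_insert_iff, Set.mem_union, Set.mem_sdiff, Set.mem_singleton_iff]
    constructor
    · rintro (rfl | (⟨⟨h1, h2⟩, -⟩ | h3))
      · exact Or.inl ⟨huI', huP₀'⟩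
      · exact Or.inl ⟨h1, h2⟩
      · exact Or.inr h3
    · rintro (⟨h1, h2⟩ | h3)
      · by_cases hxu : x = u
        · exact Or.inl hxu
        · exact Or.inr (Or.inl ⟨⟨h1, h2⟩, hxu⟩)
      · exact Or.inr (Or.inr h3)
  have hJTcl : J ∪ T ⊆ M.closure (I : Set α) :=
    Set.union_subset ((Set.sdiff_subset.trans Set.sdiff_subset).trans (M.subset_closure _ hIE)) hTcl
  have hJTE : J ∪ T ⊆ M.E := hJTcl.trans (M.closure_subset_ground _)
  -- `r((I ∖ P₀) ∪ T) = |I|`, hence `r(J ∪ T) + 1 ≥ |I|`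
  have hrfull : M.eRk (((I : Set α) \ (P₀ : Set α)) ∪ T) = (I.card : ℕ∞) := by
    have h1 : M.eRk (((I : Set α) \ (P₀ : Set α)) ∪ T) ≤ (I.card : ℕ∞) := eRk_le_card_of_subset_closure hI
      (Set.union_subset (Set.sdiff_subset.trans (M.subset_closure _ hIE)) hTcl)
    have h2 : M.eRk (I : Set α) ≤ M.eRk (((I : Set α) \ (P₀ : Set α)) ∪ T) := by
      have := M.eRk_mono hgood₀
      rwa [M.eRk_closure_eq] at this
    rw [hI.eRk_eq_encard, Set.encard_coe_eq_coe_finsetCard] at h2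
    exact le_antisymm h1 h2
  obtain ⟨k, hk⟩ := exists_eRk_eq_coe (M := M) (J ∪ T)
  have hkle : k ≤ I.card := by
    have := eRk_le_card_of_subset_closure hI hJTcl
    rw [hk] at this
    exact_mod_cast this
  have hkge : I.card ≤ k + 1 := by
    have := M.eRk_insert_le_add_one u (J ∪ T)
    rw [hJins, hrfull, hk] at this
    exact_mod_cast this
  -- the good triple `P₀ − v + u` for a suitable `v ∈ P₀`
  have hsdiff : ∀ v ∈ P₀, (I : Set α) \ ((insert u (P₀.erase v) : Finset α) : Set α) = insert v J := by
    intro v hv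
    have hvI : v ∈ (I : Set α) := by exact_mod_cast hP₀I hv
    have hvu : v ≠ u := fun hvu => huP₀ (hvu ▸ hv)
    ext x
    simp only [hJdef, Finset.coe_insert, Finset.coe_erase, Set.mem_insert_iff, Set.mem_sdiff,
      Set.mem_singleton_iff, Finset.mem_coe, not_or, not_and, not_not]
    constructor
    · rintro ⟨hxI, hxu, hxP⟩
      by_cases hxv : x = v
      · exact Or.inl hxv
      · exact Or.inr ⟨⟨hxI, fun hxP₀ => hxv (hxP hxP₀)⟩, hxu⟩
    · rintro (rfl | ⟨⟨hxI, hxP⟩, hxu⟩)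
      · exact ⟨hvI, hvu, fun _ => rfl⟩
      · exact ⟨hxI, hxu, fun hxP₀ => absurd hxP₀ hxP⟩
  have hv : ∃ v ∈ P₀, (I : Set α) ⊆ M.closure (((I : Set α) \
      ((insert u (P₀.erase v) : Finset α) : Set α)) ∪ T) := by
    by_cases hspan : (I : Set α) ⊆ M.closure (J ∪ T)
    · obtain ⟨v, hv⟩ := Finset.card_pos.1 (by rw [hP₀card]; norm_num : 0 < P₀.card)
      refine ⟨v, hv, ?_⟩
      rw [hsdiff v hv]
      exact hspan.trans (M.closure_subset_closure (Set.union_subset_union_left _ (Set.subset_insert _ _)))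
    · -- `r(J ∪ T) ≤ |I| − 1`
      have hkne : k ≠ I.card := by
        intro hkI
        apply hspan
        have := closure_eq_closure_of_eRk_eq hI hJTcl (by rw [hk, hkI])
        rw [this]
        exact M.subset_closure _ hIE
      -- some `v ∈ P₀` is outside `cl(J ∪ T)`
      have hvout : ∃ v ∈ P₀, v ∉ M.closure (J ∪ T) := by
        by_contra hall
        push Not at hall
        -- `X = I ∖ {u} ⊆ Y = X ∪ T ⊆ cl(J ∪ T)`, `r(Y) ≤ r(J ∪ T) ≤ |I| − 1 = r(X)` ⇒ `cl X = cl Y ∋ t`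
        set X : Set α := (I : Set α) \ {u} with hXdef
        have hXY : X ⊆ X ∪ T := Set.subset_union_left
        have hYcl : X ∪ T ⊆ M.closure (J ∪ T) := by
          refine Set.union_subset ?_ ((Set.subset_union_right).trans (M.subset_closure _ hJTE))
          intro x hx
          by_cases hxP : x ∈ (P₀ : Set α)
          · exact hall x (by exact_mod_cast hxP)
          · exact M.subset_closure _ hJTE (Or.inl ⟨⟨hx.1, hxP⟩, hx.2⟩)
        have hrX : M.eRk X = ((I.card - 1 : ℕ) : ℕ∞) := by
          have := eRk_coe_sdiff_coe hI (Finset.singleton_subset_iff.2 huI)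
          rw [Finset.coe_singleton, Finset.card_singleton] at this
          exact this
        have hrY : M.eRk (X ∪ T) ≤ M.eRk X := by
          have h1 : M.eRk (X ∪ T) ≤ M.eRk (M.closure (J ∪ T)) := M.eRk_mono hYcl
          rw [M.eRk_closure_eq, hk] at h1
          rw [hrX]
          exact h1.trans (by exact_mod_cast (show k ≤ I.card - 1 by omega))
        have hcl := (M.isRkFinite_set X).closure_eq_closure_of_subset_of_eRk_ge_eRk hXY hrY
        apply htu
        rw [hXdef] at hcl
        rw [hcl]
        exact M.subset_closure _ (Set.union_subset (Set.sdiff_subset.trans hIE) hTE) (Or.inr htT)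
      obtain ⟨v, hv, hvcl⟩ := hvout
      refine ⟨v, hv, ?_⟩
      rw [hsdiff v hv]
      have hvE : v ∈ M.E := hIE (by exact_mod_cast hP₀I hv)
      have hrv : M.eRk (J ∪ T) + 1 ≤ M.eRk ((J ∪ T) ∪ {v}) :=
        eRk_add_one_le_eRk_union_of_notMem_closure hvE hvcl (Set.mem_singleton v)
      have heq : (J ∪ T) ∪ {v} = insert v J ∪ T := by
        ext x
        simp only [Set.mem_union, Set.mem_insert_iff, Set.mem_singleton_iff]
        tauto
      rw [heq, hk] at hrv
      have hcl' : insert v J ∪ T ⊆ M.closure (I : Set α) :=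
        Set.union_subset (Set.insert_subset (M.subset_closure _ hIE (by exact_mod_cast hP₀I hv))
          ((Set.sdiff_subset.trans Set.sdiff_subset).trans (M.subset_closure _ hIE))) hTcl
      have hr : M.eRk (insert v J ∪ T) = (I.card : ℕ∞) := by
        have h1 := eRk_le_card_of_subset_closure hI hcl'
        refine le_antisymm h1 ?_
        exact (by exact_mod_cast hkge : (I.card : ℕ∞) ≤ (k : ℕ∞) + 1).trans hrv
      rw [closure_eq_closure_of_eRk_eq hI hcl' hr]
      exact M.subset_closure _ hIE
  obtain ⟨v, hvP₀, hgood₁⟩ := hv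
  -- the two triples `P₀` and `P₁ = P₀ − v + u`
  set P₁ : Finset α := insert u (P₀.erase v) with hP₁def
  have hP₁I : P₁ ⊆ I := by
    intro x hx
    rw [hP₁def, Finset.mem_insert] at hx
    rcases hx with rfl | hx
    · exact huI
    · exact hP₀I (Finset.mem_of_mem_erase hx)
  have hP₁card : P₁.card = 3 := by
    rw [hP₁def, Finset.card_insert_of_notMem (fun h => huP₀ (Finset.mem_of_mem_erase h)),
      Finset.card_erase_of_mem hvP₀, hP₀card]
  have hne : P₀ ≠ P₁ := by
    intro hEq
    apply huP₀
    rw [hEq, hP₁def]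
    exact Finset.mem_insert_self u _
  have hmem : ∀ P ∈ ({P₀, P₁} : Finset (Finset α)), P ∈ (I.powersetCard 3).filter
      (fun P : Finset α => (I : Set α) ⊆ M.closure (((I : Set α) \ (P : Set α)) ∪ {e, f, g, h})) := by
    intro P hP
    rw [Finset.mem_insert, Finset.mem_singleton] at hP
    rw [Finset.mem_filter, Finset.mem_powersetCard]
    rcases hP with rfl | rfl
    · exact ⟨⟨hP₀I, hP₀card⟩, hgood₀⟩
    · exact ⟨⟨hP₁I, hP₁card⟩, hgood₁⟩
  calc 2 = ({P₀, P₁} : Finset (Finset α)).card := (Finset.card_pair hne).symm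
    _ ≤ _ := Finset.card_le_card hmem

end S2

end PercRepro
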